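import Summits.ABC.IUTFork.Joshi.TestThetaLociGenuine
import Summits.ABC.IUTFork.Joshi.TestRealPinsInhabitedPrintIsm
import HarnessLib

/-!
# X-09 at GENUINE CARRIERS, the OTHER HORN of attach point A1 (R-J census row Y-11) — under PRINT's isometric (Ind2)
# (`Real.ismPrint`, [IUTchII] Ex. 1.8 (iv) `Ism(G_v)` as typed by abc-iut-c312-1) the Θ-reading of Joshi's locus satisfies
# print's «are» (BOTH halves) at abc-iut-E-t41's honest real setting — inside rp-h3's `OrbitInside`, where READING R3 fails

Proof-only sequel (0 definitions, 0 `Prop` facts, no `sorry`; abc-iut cell, block E / R-J census, rung LADDER-ABC:A2.E; seat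
abc-iut-E-t22, gen 8) of `Joshi/TestThetaLociGenuine.lean` (p451250), `…Mover` (p453604), `…Initial` (p454054): there, under
Dupuy–Hilado's (Ind2) `Real.ismDH` (ALL bicontinuous lattice automorphisms of the log-shell, arXiv:2004.13228 §4.9) the ⊇-half of [J-III]
Thm-Def 9.8.1.1 (7) «[the loci] are Mochizuki's multi-radial representations of Theta-values» (arXiv:2401.13508v4 p.116 l.43–50;
K. Joshi, unrefereed) FAILS for every Θ-inside reading at the genuine sharp setting of every initial Θ-datum. THIS FILE records the
other horn of E-LOCATION's attach point A1 AT GENUINE CARRIERS (not at a toy): abc-iut-E-t41's HONEST real setting `honestSetting`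
(`Joshi/TestRealHonestPacket.lean` p445387 lineage: abc-iut-c312-5's generic real shells `Real.logShells X logv Aut Ism`, printed-SHAPE
pilot boxes — Θ: `e⁻¹(p·𝒪_L)` at every `(m, j, v_ℚ)`, q: `e⁻¹(𝒪_L)` —, verbatim volumes) with an (Ind2)-binder acting by NORM-ONE UNIT
multiplications and a trivial strip binder — in particular PRINT's own (Ind2) `Real.ismPrint logv` (abc-iut-c312-1
`Thm311RealInd2IsmSignature`: [IUTchII] Ex. 1.8 (iv) `G_v`-isometries of `𝒪^{×μ}`, realised on `K_v`; they act as unit scalars,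
`Real.exists_unit_scalar_presAt`) over `Real.logShellsIsm` — where abc-iut-E-t58 proved (R-J row Y-29, p449694/p450628) that EVERY
element of `⟨(Ind1) ∪ (Ind2)⟩` FIXES every Θ-region and the q-region (`PinsInhabited.honestSetting_regions_invariant_of_unitIsm`):

* `sUnion_possibleImages_honestSetting_of_unitIsm` — the union of the possible images IS the (Ind3)-region (the multiradial orbit
  of the Θ-pilot region is the region itself); `orbitInside_honestSetting_of_unitIsm` — rp-h3's class `OrbitInside` HOLDS there;
* `thetaReading_both_honestSetting_of_unitIsm` — every reading of Joshi's locus whose locus IS the (Ind3)-region (THE Θ-reading) has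
  BOTH halves of «are» and the hull row; `exists_thetaReading_both_honestSetting_of_unitIsm` — and such a reading exists (E-t22's
  region signature p431723 on the non-empty Θ-regions);
* `qRegion_not_mem_possibleImages_honestSetting_of_unitIsm` — while READING R3 «the q-pilot region is a possible image» FAILS at
  every label over `p` (the only possible image is the Θ-region, of log-volume `< 0` at `p`, abc-iut-E-t41
  `honestSetting_logvol_thetaRegion_neg`; the q-region has log-volume `0`, `honestSetting_logvol_qRegion`) — the identification-level
  residual behind S (`Cor312.reading3_iff_pilotKummerIndRelated` under the pins, which ARE inhabited there: E-t58
  `exists_pinnedRegions_honestSetting_of_unitIsm`);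
* §2 the same at PRINT's binder: `…_ismPrint` versions over `Real.logShellsIsm X logv`.

CENSUS SENTENCE (Y-11, located A1, no verdict): at genuine carriers the dictionary row (7) behaves EXACTLY as at the toy models —
under an ISOMETRIC (Ind2) (print-literal `Real.ismPrint`, or any norm-one unit multiplications) the Θ-reading has BOTH halves of «are»
and the multiradial orbit is trivial, so READING R3 / covering of the q-region fails (pinned-model profile p431723, at real carriers);
under Dupuy–Hilado's lattice-automorphism (Ind2) the ⊇-half FAILS at every initial Θ-datum (p454054; `scalSetting` profile p434792).
Which (Ind2) [IUTchIII] Thm. 3.11 (i) intends is attach point A1 (E-LOCATION §L1) — recorded, not adjudicated. **No side is taken** on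
[IUTchIII] Cor. 3.12 or on any author (Mochizuki / Joshi / Dupuy–Hilado / Scholze–Stix); typed ≠ proved; instantiated ≠ endorsed;
R13 «J-TRUE/FALSE-AT-GENUINE» DATA. [claim: Joshi2024ATS3, status: disputed] [claim: Mochizuki2012, status: disputed]
[cite: DupuyHilado2025, §4.7, §4.9] [cite: Mochizuki2012, IUTchIV Prop. 1.4 (i) p. 13]
-/

noncomputable section

open Set Function NumberField IsDedekindDomain
open scoped Pointwise

namespace Summit.ABC.IUTFork.Joshi

open Thm311 Thm311.Real Cor312 Cor312Vol Literature.IUT.LogThetaLattice Literature.IUT.LogVolume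
open Summit.ABC.IUTFork.Repair.CandDupuyHilado32 (OrbitInside)

/-! ## 1. Norm-one unit (Ind2), trivial strip binder: the multiradial orbit of the Θ-region is trivial -/

section Honest

variable {F : Type} [Field F] [NumberField F] (X : PilotData F) {logv : PadicLogs F} (hlog : LogvAnalytic logv)
  {Aut Ism : ∀ x : Thm311.Real.Place F, Set (Thm311.Real.Carrier x ≃ₗ[ℚ] Thm311.Real.Carrier x)}
  (hAut : ∀ x, LinearEquiv.refl ℚ (Thm311.Real.Carrier x) ∈ Aut x) (hIsm : ∀ x, LinearEquiv.refl ℚ (Thm311.Real.Carrier x) ∈ Ism x)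
  (M : Type) [Field M] [NumberField M]
  (archPk : ∀ (j : (thetaIndex X).Label) (vQ : (thetaIndex X).VQ), Set ((logShells X logv Aut Ism hAut hIsm).Packet j vQ))
  (archSub : ∀ (j : (thetaIndex X).Label) (v : (thetaIndex X).V),
    Set ((logShells X logv Aut Ism hAut hIsm).Packet j ((thetaIndex X).over v)))
  (Ψ : ℤ → ∀ v : (thetaIndex X).V, v ∈ (thetaIndex X).Vbad → Set ((logShells X logv Aut Ism hAut hIsm).StarPacket v))
  (act : ℤ → ∀ v : (thetaIndex X).V, v ∈ (thetaIndex X).Vbad →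
    (logShells X logv Aut Ism hAut hIsm).StarPacket v → Module.End ℚ ((logShells X logv Aut Ism hAut hIsm).StarPacket v))
  (Mmod : ℤ → ∀ j : (thetaIndex X).LabelStar, Set ((logShells X logv Aut Ism hAut hIsm).GlobalPacket j.1))
  (region : ℤ → ∀ j : (thetaIndex X).LabelStar, FinDivisor M → ∀ vQ : (thetaIndex X).VQ,
    Set ((logShells X logv Aut Ism hAut hIsm).Packet j.1 vQ))
  (col : ℤ → Column (logShells X logv Aut Ism hAut hIsm)) (n : ℤ) (p : ℕ) [hp : Fact p.Prime]
  (hAutT : ∀ x, ∀ g ∈ Aut x, g = LinearEquiv.refl ℚ (Thm311.Real.Carrier x))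
  (hIsmU : ∀ (pp : Nat.Primes) (x : (thetaIndex X).Fibre (.inr pp)), ∀ g ∈ Ism x.1,
    haveI : Fact (pp : ℕ).Prime := ⟨pp.2⟩
    ∃ c : (presAt X hlog pp).k x, ‖c‖ = 1 ∧ ∀ a, (presAt X hlog pp).φ x (g a) = c * (presAt X hlog pp).φ x a)
  {W : Type} {V : W → Type} [∀ w, TopologicalSpace (V w)] {TJ TM : Type} [TopologicalSpace TJ] [TopologicalSpace TM]
  {C : ATS3.TensorPacketLociDatum W V TJ TM}

include hAutT hIsmU

/-- **Every indeterminacy fixes the (Ind3)-enlarged Θ-region of the honest setting** (unit (Ind2), trivial strip binder):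
`Φ '' ⋃ₘ thetaRegion m = ⋃ₘ Φ '' thetaRegion m = ⋃ₘ thetaRegion m` by abc-iut-E-t58's `honestSetting_regions_invariant_of_unitIsm`.
[cite: DupuyHilado2025, §4.7, §4.9] -/
theorem image_thetaRegion3_honestSetting_of_unitIsm {Φ : (logShells X logv Aut Ism hAut hIsm).PacketAut}
    (hΦ : Φ ∈ Setting.indGroup (latticeSituationReal X hlog Aut Ism hAut hIsm M archPk archSub Ψ act Mmod region col).toSituation)
    (j : (thetaIndex X).Label) (vQ : (thetaIndex X).VQ) :
    Φ j vQ '' (honestSetting X hlog Aut Ism hAut hIsm M archPk archSub Ψ act Mmod region col n p).thetaRegion3 j vQ =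
      (honestSetting X hlog Aut Ism hAut hIsm M archPk archSub Ψ act Mmod region col n p).thetaRegion3 j vQ := by
  have hinv := fun m : ℤ =>
    (PinsInhabited.honestSetting_regions_invariant_of_unitIsm X hlog hAut hIsm M archPk archSub Ψ act Mmod region col n p hAutT
      hIsmU hΦ m j vQ).1
  simp only [Setting.thetaRegion3]
  refine Subset.antisymm ?_ fun x hx => ?_
  · rintro _ ⟨x, hx, rfl⟩
    obtain ⟨m, hm⟩ := Set.mem_iUnion.mp hx
    exact Set.mem_iUnion.mpr ⟨m, (hinv m).le (Set.mem_image_of_mem _ hm)⟩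
  · obtain ⟨m, hm⟩ := Set.mem_iUnion.mp hx
    obtain ⟨y, hy, hyx⟩ := (hinv m).ge hm
    exact ⟨y, Set.mem_iUnion.mpr ⟨m, hy⟩, hyx⟩

/-- **The union of the possible images IS the (Ind3)-region** at the honest setting under the unit (Ind2): the multiradial orbit of
the Θ-pilot region is trivial. [cite: DupuyHilado2025, §4.7, §4.9] [claim: Mochizuki2012, status: disputed] -/
theorem sUnion_possibleImages_honestSetting_of_unitIsm (j : (thetaIndex X).Label) (vQ : (thetaIndex X).VQ) :
    ⋃₀ (honestSetting X hlog Aut Ism hAut hIsm M archPk archSub Ψ act Mmod region col n p).possibleImages j vQ =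
      (honestSetting X hlog Aut Ism hAut hIsm M archPk archSub Ψ act Mmod region col n p).thetaRegion3 j vQ := by
  refine Subset.antisymm (sUnion_subset fun U hU => ?_)
    (subset_sUnion_of_mem ((honestSetting X hlog Aut Ism hAut hIsm M archPk archSub Ψ act Mmod region col n
      p).thetaRegion3_mem_possibleImages j vQ))
  obtain ⟨Φ, hΦ, rfl⟩ := hU
  exact (image_thetaRegion3_honestSetting_of_unitIsm X hlog hAut hIsm M archPk archSub Ψ act Mmod region col n p hAutT hIsmU hΦ
    j vQ).le

/-- Every possible image IS the (Ind3)-region: the family of possible images is the singleton `{thetaRegion3}`. [folklore] -/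
theorem possibleImages_honestSetting_of_unitIsm (j : (thetaIndex X).Label) (vQ : (thetaIndex X).VQ) :
    (honestSetting X hlog Aut Ism hAut hIsm M archPk archSub Ψ act Mmod region col n p).possibleImages j vQ =
      {(honestSetting X hlog Aut Ism hAut hIsm M archPk archSub Ψ act Mmod region col n p).thetaRegion3 j vQ} := by
  refine Subset.antisymm (fun U hU => ?_) ?_
  · obtain ⟨Φ, hΦ, rfl⟩ := hU
    exact image_thetaRegion3_honestSetting_of_unitIsm X hlog hAut hIsm M archPk archSub Ψ act Mmod region col n p hAutT hIsmU hΦ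
      j vQ
  · rintro U rfl
    exact (honestSetting X hlog Aut Ism hAut hIsm M archPk archSub Ψ act Mmod region col n p).thetaRegion3_mem_possibleImages j vQ

/-- **rp-h3's class `OrbitInside` HOLDS at the honest setting under the unit (Ind2)** (every Kummer image is the `m = 0` one,
`rfl`). [cite: DupuyHilado2025, §4.7, §4.9] [cite: DupuyHilado2020, §6.2 pp. 19–20] -/
theorem orbitInside_honestSetting_of_unitIsm :
    OrbitInside (latticeSituationReal X hlog Aut Ism hAut hIsm M archPk archSub Ψ act Mmod region col)
      (honestSetting X hlog Aut Ism hAut hIsm M archPk archSub Ψ act Mmod region col n p) := fun _ hΦ _ vQ =>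
  (image_thetaRegion3_honestSetting_of_unitIsm X hlog hAut hIsm M archPk archSub Ψ act Mmod region col n p hAutT hIsmU hΦ _
    vQ).le.trans (iUnion_subset fun _ => subset_of_eq rfl)

/-- **THE POSITIVE HORN FOR THE Θ-READING: BOTH halves of print's «are» and the hull row HOLD** at the honest setting under the
unit (Ind2), for every reading of every loci signature whose locus IS the (Ind3)-region in every packet (contrast p454054 under
Dupuy–Hilado's (Ind2): the ⊇-half fails). J-TRUE-AT-GENUINE data (R13). [claim: Joshi2024ATS3, status: disputed]
[claim: Mochizuki2012, status: disputed] -/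
theorem thetaReading_both_honestSetting_of_unitIsm
    {𝔇 : Dictionary (latticeSituationReal X hlog Aut Ism hAut hIsm M archPk archSub Ψ act Mmod region col)}
    (R : LociReading (honestSetting X hlog Aut Ism hAut hIsm M archPk archSub Ψ act Mmod region col n p) C 𝔇)
    (hR : ∀ (j : (thetaIndex X).Label) (vQ : (thetaIndex X).VQ), R.locusRegion j vQ =
      (honestSetting X hlog Aut Ism hAut hIsm M archPk archSub Ψ act Mmod region col n p).thetaRegion3 j vQ) :
    R.LocusWithinPossibleImages ∧ R.PossibleImagesWithinLocus ∧ R.LocusWithinHull := by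
  have hboth : R.LocusWithinPossibleImages ∧ R.PossibleImagesWithinLocus :=
    (both_iff_locus_eq_sUnion R).2 fun j vQ => (hR j vQ).trans
      (sUnion_possibleImages_honestSetting_of_unitIsm X hlog hAut hIsm M archPk archSub Ψ act Mmod region col n p hAutT hIsmU j
        vQ).symm
  exact ⟨hboth.1, hboth.2, R.locusWithinHull_of_locusWithinPossibleImages hboth.1⟩

omit hp hAutT hIsmU in
/-- The (Ind3)-region of the honest setting is non-empty in every packet (`0 ∈ e⁻¹(p·𝒪_L)`). [folklore] -/
theorem thetaRegion3_honestSetting_nonempty (j : (thetaIndex X).Label) (vQ : (thetaIndex X).VQ) :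
    ((honestSetting X hlog Aut Ism hAut hIsm M archPk archSub Ψ act Mmod region col n p).thetaRegion3 j vQ).Nonempty := by
  refine ⟨0, Set.mem_iUnion.mpr ⟨0, ?_⟩⟩
  rw [honestSetting_thetaRegion]
  show factorMapDH X hlog j vQ 0 ∈ hullSet (factorFieldDH X hlog j vQ) fun s => (p : factorFieldDH X hlog j vQ s)
  rw [hullSet, mem_polydisc]
  cases vQ with
  | inl u => exact fun s => s.elim
  | inr pp =>
    haveI : Fact (pp : ℕ).Prime := ⟨pp.2⟩
    intro s
    change ‖(presAt X hlog pp).factorMap j 0 s‖ ≤ _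
    unfold PadicPresentation.factorMap
    rw [map_zero, Pi.zero_apply, map_zero, Pi.zero_apply, norm_zero]
    exact norm_nonneg _

/-- **… and THE Θ-reading EXISTS there with that profile** (E-t22's region signature p431723 on the non-empty Θ-regions; any seed
dictionary): «are» (both halves) ∧ hull row — the pinned-model profile (p431723 `pinned_theta_split`) AT GENUINE CARRIERS.
[claim: Joshi2024ATS3, status: disputed] [claim: Mochizuki2012, status: disputed] -/
theorem exists_thetaReading_both_honestSetting_of_unitIsm
    (𝔇 : Dictionary (latticeSituationReal X hlog Aut Ism hAut hIsm M archPk archSub Ψ act Mmod region col)) :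
    ∃ R : LociReading (honestSetting X hlog Aut Ism hAut hIsm M archPk archSub Ψ act Mmod region col n p)
        (regionLoci (latticeSituationReal X hlog Aut Ism hAut hIsm M archPk archSub Ψ act Mmod region col) _
          (thetaRegion3_honestSetting_nonempty X hlog hAut hIsm M archPk archSub Ψ act Mmod region col n p)) 𝔇,
      R.LocusWithinPossibleImages ∧ R.PossibleImagesWithinLocus ∧ R.LocusWithinHull := by
  obtain ⟨R, hR⟩ := exists_thetaReading
    (P := honestSetting X hlog Aut Ism hAut hIsm M archPk archSub Ψ act Mmod region col n p) 𝔇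
    (thetaRegion3_honestSetting_nonempty X hlog hAut hIsm M archPk archSub Ψ act Mmod region col n p)
  exact ⟨R, thetaReading_both_honestSetting_of_unitIsm X hlog hAut hIsm M archPk archSub Ψ act Mmod region col n p hAutT hIsmU R hR⟩

omit hAutT hIsmU in
/-- Over `p` the q-region is NOT the (Ind3)-region at a label of `𝔽_l^⋇` (log-volumes `0` vs `< 0`, abc-iut-E-t41
`honestSetting_logvol_qRegion` / `honestSetting_logvol_thetaRegion_neg`). [cite: Mochizuki2012, IUTchIV Prop. 1.4 (i) p. 13] -/
theorem qRegion_ne_thetaRegion3_honestSetting (j : (thetaIndex X).Label) :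
    (honestSetting X hlog Aut Ism hAut hIsm M archPk archSub Ψ act Mmod region col n p).qRegion j (.inr (ratPrime p)) ≠
      (honestSetting X hlog Aut Ism hAut hIsm M archPk archSub Ψ act Mmod region col n p).thetaRegion3 j (.inr (ratPrime p)) := by
  have h3 : (honestSetting X hlog Aut Ism hAut hIsm M archPk archSub Ψ act Mmod region col n p).thetaRegion3 j (.inr (ratPrime p)) =
      (honestSetting X hlog Aut Ism hAut hIsm M archPk archSub Ψ act Mmod region col n p).thetaRegion 0 j (.inr (ratPrime p)) :=
    Subset.antisymm (iUnion_subset fun _ => subset_of_eq rfl) fun x hx => Set.mem_iUnion.mpr ⟨0, hx⟩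
  intro heq
  have hq := honestSetting_logvol_qRegion (X := X) (hlog := hlog) (hAut := hAut) (hIsm := hIsm) (M := M) (archPk := archPk)
    (archSub := archSub) (Ψ := Ψ) (act := act) (Mmod := Mmod) (region := region) (col := col) (n := n) (p := p) j (.inr (ratPrime p))
  have hΘ := honestSetting_logvol_thetaRegion_neg (X := X) (hlog := hlog) (hAut := hAut) (hIsm := hIsm) (M := M) (archPk := archPk)
    (archSub := archSub) (Ψ := Ψ) (act := act) (Mmod := Mmod) (region := region) (col := col) (n := n) (p := p) 0 j
  rw [heq, h3] at hq
  exact absurd hq (ne_of_lt hΘ)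

/-- **READING R3 FAILS inside the class**: under the unit (Ind2) the q-region over `p` is NOT a possible image of the Θ-pilot at any
label (the only possible image is the (Ind3)-region) — so, under the pins (inhabited there, E-t58
`exists_pinnedRegions_honestSetting_of_unitIsm`) and Thm. 3.11 (ii)(b) at the column, S fails by abc-iut-w5-d230's
`Cor312.reading3_iff_pilotKummerIndRelated` (BY NAME; not re-derived here): the pinned-model profile «“are” ✓, R3 ✗» at genuine
carriers. [claim: Mochizuki2012, status: disputed] -/
theorem qRegion_not_mem_possibleImages_honestSetting_of_unitIsm (j : (thetaIndex X).Label) :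
    (honestSetting X hlog Aut Ism hAut hIsm M archPk archSub Ψ act Mmod region col n p).qRegion j (.inr (ratPrime p)) ∉
      (honestSetting X hlog Aut Ism hAut hIsm M archPk archSub Ψ act Mmod region col n p).possibleImages j (.inr (ratPrime p)) := by
  rw [possibleImages_honestSetting_of_unitIsm X hlog hAut hIsm M archPk archSub Ψ act Mmod region col n p hAutT hIsmU,
    Set.mem_singleton_iff]
  exact qRegion_ne_thetaRegion3_honestSetting X hlog hAut hIsm M archPk archSub Ψ act Mmod region col n p j

/-- … hence the identification-level READING R3 «the q-pilot region is a possible image in every packet» is FALSE there.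
[claim: Mochizuki2012, status: disputed] -/
theorem not_reading3_honestSetting_of_unitIsm :
    ¬ ∀ (j : (thetaIndex X).Label) (vQ : (thetaIndex X).VQ),
      (honestSetting X hlog Aut Ism hAut hIsm M archPk archSub Ψ act Mmod region col n p).qRegion j vQ ∈
        (honestSetting X hlog Aut Ism hAut hIsm M archPk archSub Ψ act Mmod region col n p).possibleImages j vQ := fun h =>
  qRegion_not_mem_possibleImages_honestSetting_of_unitIsm X hlog hAut hIsm M archPk archSub Ψ act Mmod region col n p hAutT hIsmU 0
    (h 0 _)

end Honest

/-! ## 2. PRINT's own (Ind2) `Real.ismPrint` over `Real.logShellsIsm` -/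

section Print

variable {F : Type} [Field F] [NumberField F] (X : PilotData F) {logv : PadicLogs F} (hlog : LogvAnalytic logv)
  (M : Type) [Field M] [NumberField M]
  (archPk : ∀ (j : (thetaIndex X).Label) (vQ : (thetaIndex X).VQ), Set ((logShellsIsm X logv).Packet j vQ))
  (archSub : ∀ (j : (thetaIndex X).Label) (v : (thetaIndex X).V), Set ((logShellsIsm X logv).Packet j ((thetaIndex X).over v)))
  (Ψ : ℤ → ∀ v : (thetaIndex X).V, v ∈ (thetaIndex X).Vbad → Set ((logShellsIsm X logv).StarPacket v))
  (act : ℤ → ∀ v : (thetaIndex X).V, v ∈ (thetaIndex X).Vbad →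
    (logShellsIsm X logv).StarPacket v → Module.End ℚ ((logShellsIsm X logv).StarPacket v))
  (Mmod : ℤ → ∀ j : (thetaIndex X).LabelStar, Set ((logShellsIsm X logv).GlobalPacket j.1))
  (region : ℤ → ∀ j : (thetaIndex X).LabelStar, FinDivisor M → ∀ vQ : (thetaIndex X).VQ,
    Set ((logShellsIsm X logv).Packet j.1 vQ))
  (col : ℤ → Column (logShellsIsm X logv)) (n : ℤ) (p : ℕ) [hp : Fact p.Prime]
  {W : Type} {V : W → Type} [∀ w, TopologicalSpace (V w)] {TJ TM : Type} [TopologicalSpace TJ] [TopologicalSpace TM]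
  {C : ATS3.TensorPacketLociDatum W V TJ TM}

/-- **At PRINT's (Ind2) `Real.ismPrint` the multiradial orbit of the Θ-region of the honest setting is trivial and `OrbitInside`
holds** (print's Ism acts by unit scalars, abc-iut-E-t58 `presented_unit_of_ismPrint`). [claim: Mochizuki2012, status: disputed] -/
theorem orbitInside_honestSetting_ismPrint :
    OrbitInside
      (latticeSituationReal X hlog stripAutDH (ismPrint logv) refl_mem_stripAutDH (refl_mem_ismPrint logv) M archPk archSub Ψ act
        Mmod region col)
      (honestSetting X hlog stripAutDH (ismPrint logv) refl_mem_stripAutDH (refl_mem_ismPrint logv) M archPk archSub Ψ act Mmod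
        region col n p) :=
  orbitInside_honestSetting_of_unitIsm X hlog refl_mem_stripAutDH (refl_mem_ismPrint logv) M archPk archSub Ψ act Mmod region col n
    p (fun _ _ hg => hg) (fun pp x => PinsInhabited.presented_unit_of_ismPrint X hlog pp x)

/-- **Y-11 POSITIVE HORN AT PRINT's (Ind2): the Θ-reading of Joshi's locus has BOTH halves of «are» and the hull row** at the honest
real setting over `Real.logShellsIsm X logv`, for every pilot datum, analytic `logv`, columns and prime, and every seed dictionary —
while READING R3 fails there (`not_reading3_honestSetting_ismPrint`). [claim: Joshi2024ATS3, status: disputed]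
[claim: Mochizuki2012, status: disputed] -/
theorem exists_thetaReading_both_honestSetting_ismPrint
    (𝔇 : Dictionary (latticeSituationReal X hlog stripAutDH (ismPrint logv) refl_mem_stripAutDH (refl_mem_ismPrint logv) M archPk
      archSub Ψ act Mmod region col)) :
    ∃ R : LociReading
        (honestSetting X hlog stripAutDH (ismPrint logv) refl_mem_stripAutDH (refl_mem_ismPrint logv) M archPk archSub Ψ act Mmod
          region col n p)
        (regionLoci
          (latticeSituationReal X hlog stripAutDH (ismPrint logv) refl_mem_stripAutDH (refl_mem_ismPrint logv) M archPk archSub Ψ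
            act Mmod region col) _
          (thetaRegion3_honestSetting_nonempty X hlog refl_mem_stripAutDH (refl_mem_ismPrint logv) M archPk archSub Ψ act Mmod
            region col n p)) 𝔇,
      R.LocusWithinPossibleImages ∧ R.PossibleImagesWithinLocus ∧ R.LocusWithinHull :=
  exists_thetaReading_both_honestSetting_of_unitIsm X hlog refl_mem_stripAutDH (refl_mem_ismPrint logv) M archPk archSub Ψ act Mmod
    region col n p (fun _ _ hg => hg) (fun pp x => PinsInhabited.presented_unit_of_ismPrint X hlog pp x) 𝔇

/-- **… while READING R3 fails at PRINT's (Ind2)**: the q-region over `p` is not a possible image of the Θ-pilot.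
[claim: Mochizuki2012, status: disputed] -/
theorem not_reading3_honestSetting_ismPrint :
    ¬ ∀ (j : (thetaIndex X).Label) (vQ : (thetaIndex X).VQ),
      (honestSetting X hlog stripAutDH (ismPrint logv) refl_mem_stripAutDH (refl_mem_ismPrint logv) M archPk archSub Ψ act Mmod
          region col n p).qRegion j vQ ∈
        (honestSetting X hlog stripAutDH (ismPrint logv) refl_mem_stripAutDH (refl_mem_ismPrint logv) M archPk archSub Ψ act Mmod
          region col n p).possibleImages j vQ :=
  not_reading3_honestSetting_of_unitIsm X hlog refl_mem_stripAutDH (refl_mem_ismPrint logv) M archPk archSub Ψ act Mmod region col n p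
    (fun _ _ hg => hg) (fun pp x => PinsInhabited.presented_unit_of_ismPrint X hlog pp x)

end Print

end Summit.ABC.IUTFork.Joshi

end
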